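import Summits.Ventures.Crystal3D.Theorems.StickyWulffConstantNoReconstructionGainRegistry
import HarnessLib

/-!
# R26 reduction L5 in the kernel: only the off-registry balls need a certificate

HONEST FRAMING. Part of the venture `Summits/Ventures/Crystal3D` (cell `crystal3d-full`), helper
`--supports` the crux `NoReconstructionGain` (stmt-Ventures-19144, route
`route-Ventures-StickyWulffConstant`), line `adhesion`; continues `…Certificate`, `…Peeling`,
`…OffLattice`, `…Registry`.  cf-p2's R26 reduction **L5** («registry balls below off-registry
ones ⇒ T2-existence for all films ⇐ T2-existence for films of off-lattice balls») as a theorem: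

* `slabGauge_*` — the convex gauge `f(y) = max (ρ²(2⟪y,ν⟫ + 3R)², R²(‖y‖² − ⟪y,ν⟫²))` of the slab
  sample region `K = {−2R ≤ ⟪y,ν⟫ ≤ −R, ‖y‖² − ⟪y,ν⟫² ≤ ρ²}`: `f ≤ R²ρ²` on `K`, `> R²ρ²` off `K`,
  midpoint-convex;
* `rank_lt_iff` / `rank_eq_iff` — an integer potential with the order of a real function;
* `exists_potential_of_offRegistry` — `X ⊇ P` a unit packing around the `ν`-slab sample `P`,
  `O ⊆ X \ P` with every other film ball a site of `Λ₀`; if an integer potential `Ψ` satisfies (T2)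
  at every `q ∈ O \ E` for the ENLARGED plug `X \ O = P ∪ (registry film)`, then some `Φ`
  satisfies (T2) relative to `P` at every film ball off `E` (registry balls: `…Registry`, gauge
  order; off-registry balls: `Ψ` lifted above all registry balls);
* `potentialCertificateExists_of_offRegistry` — the quantified closed form: cf-p2's
  `PotentialCertificateExists` (hence the atom `stub_adhesion`, `adhesion_of_certificate`) follows
  from certificates for the OFF-REGISTRY balls alone, relative to lattice plugs — where every such
  ball has at most THREE plug partners (`fcc_offLattice_unitContacts_le_three`).

WHAT THIS IS NOT: a certificate for any off-registry film; rung F-C1 not moved.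
-/

noncomputable section

namespace Summit.Ventures.Crystal3D.Theorems

open Summit.Ventures.Crystal3D Finset
open Literature.MathematicalPhysics.StatisticalMechanics (fccStacking orderedContacts contactDeficiency)
open scoped InnerProductSpace

/-! ### The slab gauge -/

/-- On the slab sample region the gauge is at most `R² ρ²`. -/
theorem slabGauge_le (ν : EuclideanSpace ℝ (Fin 3)) (R ρ : ℝ) (p : EuclideanSpace ℝ (Fin 3))
    (h1 : -(2 * R) ≤ ⟪p, ν⟫_ℝ) (h2 : ⟪p, ν⟫_ℝ ≤ -R) (h3 : ‖p‖ ^ 2 - ⟪p, ν⟫_ℝ ^ 2 ≤ ρ ^ 2) :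
    max (ρ ^ 2 * (2 * ⟪p, ν⟫_ℝ + 3 * R) ^ 2) (R ^ 2 * (‖p‖ ^ 2 - ⟪p, ν⟫_ℝ ^ 2)) ≤ R ^ 2 * ρ ^ 2 := by
  refine max_le ?_ ?_
  · have : (2 * ⟪p, ν⟫_ℝ + 3 * R) ^ 2 ≤ R ^ 2 := by nlinarith
    nlinarith [sq_nonneg ρ]
  · nlinarith [sq_nonneg R]

/-- Off the slab sample region the gauge exceeds `R² ρ²` (`R, ρ > 0`). -/
theorem lt_slabGauge (ν : EuclideanSpace ℝ (Fin 3)) (R ρ : ℝ) (hR : 0 < R) (hρ : 0 < ρ)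
    (q : EuclideanSpace ℝ (Fin 3))
    (h : ¬(-(2 * R) ≤ ⟪q, ν⟫_ℝ ∧ ⟪q, ν⟫_ℝ ≤ -R ∧ ‖q‖ ^ 2 - ⟪q, ν⟫_ℝ ^ 2 ≤ ρ ^ 2)) :
    R ^ 2 * ρ ^ 2 < max (ρ ^ 2 * (2 * ⟪q, ν⟫_ℝ + 3 * R) ^ 2) (R ^ 2 * (‖q‖ ^ 2 - ⟪q, ν⟫_ℝ ^ 2)) := by
  have hρ2 : 0 < ρ ^ 2 := by positivity
  have hR2 : 0 < R ^ 2 := by positivity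
  by_cases h3 : ‖q‖ ^ 2 - ⟪q, ν⟫_ℝ ^ 2 ≤ ρ ^ 2
  · have h12 : ¬(-(2 * R) ≤ ⟪q, ν⟫_ℝ ∧ ⟪q, ν⟫_ℝ ≤ -R) := fun h' => h ⟨h'.1, h'.2, h3⟩
    refine lt_of_lt_of_le ?_ (le_max_left _ _)
    have hsq : R ^ 2 < (2 * ⟪q, ν⟫_ℝ + 3 * R) ^ 2 := by
      rcases not_and_or.1 h12 with h1 | h2
      · push Not at h1; nlinarith
      · push Not at h2; nlinarith
    nlinarith
  · push Not at h3
    refine lt_of_lt_of_le ?_ (le_max_right _ _)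
    nlinarith

/-- The gauge is midpoint-convex (`‖ν‖ = 1`): `2 f(q) ≤ f(q + w) + f(q − w)`. -/
theorem slabGauge_midpoint (ν : EuclideanSpace ℝ (Fin 3)) (hν : ‖ν‖ = 1) (R ρ : ℝ)
    (q w : EuclideanSpace ℝ (Fin 3)) :
    2 * max (ρ ^ 2 * (2 * ⟪q, ν⟫_ℝ + 3 * R) ^ 2) (R ^ 2 * (‖q‖ ^ 2 - ⟪q, ν⟫_ℝ ^ 2)) ≤
      max (ρ ^ 2 * (2 * ⟪q + w, ν⟫_ℝ + 3 * R) ^ 2) (R ^ 2 * (‖q + w‖ ^ 2 - ⟪q + w, ν⟫_ℝ ^ 2)) +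
      max (ρ ^ 2 * (2 * ⟪q - w, ν⟫_ℝ + 3 * R) ^ 2) (R ^ 2 * (‖q - w‖ ^ 2 - ⟪q - w, ν⟫_ℝ ^ 2)) := by
  have hw : ⟪w, ν⟫_ℝ ^ 2 ≤ ‖w‖ ^ 2 := by
    have h := abs_real_inner_le_norm w ν
    rw [hν, mul_one] at h
    have := sq_le_sq' (abs_le.1 h).1 (abs_le.1 h).2
    simpa using this
  have hp : ‖q + w‖ ^ 2 = ‖q‖ ^ 2 + 2 * ⟪q, w⟫_ℝ + ‖w‖ ^ 2 := norm_add_sq_real q w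
  have hm : ‖q - w‖ ^ 2 = ‖q‖ ^ 2 - 2 * ⟪q, w⟫_ℝ + ‖w‖ ^ 2 := norm_sub_sq_real q w
  rw [inner_add_left, inner_sub_left]
  have ha : 2 * (ρ ^ 2 * (2 * ⟪q, ν⟫_ℝ + 3 * R) ^ 2) ≤
      ρ ^ 2 * (2 * (⟪q, ν⟫_ℝ + ⟪w, ν⟫_ℝ) + 3 * R) ^ 2 +
        ρ ^ 2 * (2 * (⟪q, ν⟫_ℝ - ⟪w, ν⟫_ℝ) + 3 * R) ^ 2 := by
    nlinarith [sq_nonneg (ρ * ⟪w, ν⟫_ℝ)]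
  have hb : 2 * (R ^ 2 * (‖q‖ ^ 2 - ⟪q, ν⟫_ℝ ^ 2)) ≤
      R ^ 2 * (‖q + w‖ ^ 2 - (⟪q, ν⟫_ℝ + ⟪w, ν⟫_ℝ) ^ 2) +
        R ^ 2 * (‖q - w‖ ^ 2 - (⟪q, ν⟫_ℝ - ⟪w, ν⟫_ℝ) ^ 2) := by
    rw [hp, hm]; nlinarith [sq_nonneg R]
  rcases le_total (ρ ^ 2 * (2 * ⟪q, ν⟫_ℝ + 3 * R) ^ 2) (R ^ 2 * (‖q‖ ^ 2 - ⟪q, ν⟫_ℝ ^ 2)) with h | h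
  · rw [max_eq_right h]
    exact hb.trans (add_le_add (le_max_right _ _) (le_max_right _ _))
  · rw [max_eq_left h]
    exact ha.trans (add_le_add (le_max_left _ _) (le_max_left _ _))

/-! ### Integer potentials with a prescribed order -/

/-- The rank `#{y ∈ R : f y < f x}` has the order of `f` on `R`: strict part. -/
theorem rank_lt_iff (R : Finset (EuclideanSpace ℝ (Fin 3))) (f : EuclideanSpace ℝ (Fin 3) → ℝ)
    (x q : EuclideanSpace ℝ (Fin 3)) (hx : x ∈ R) :
    ((R.filter fun y => f y < f x).card : ℤ) < ((R.filter fun y => f y < f q).card : ℤ) ↔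
      f x < f q := by
  have mono : ∀ a b : EuclideanSpace ℝ (Fin 3), f a ≤ f b →
      (R.filter fun y => f y < f a).card ≤ (R.filter fun y => f y < f b).card :=
    fun a b hab => card_le_card (fun y hy => by
      rw [mem_filter] at hy ⊢; exact ⟨hy.1, lt_of_lt_of_le hy.2 hab⟩)
  have strict : ∀ a b : EuclideanSpace ℝ (Fin 3), a ∈ R → f a < f b →
      (R.filter fun y => f y < f a).card < (R.filter fun y => f y < f b).card := by
    intro a b ha hab
    refine card_lt_card ⟨fun y hy => ?_, fun hsub => ?_⟩
    · rw [mem_filter] at hy ⊢; exact ⟨hy.1, hy.2.trans hab⟩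
    · have : a ∈ R.filter fun y => f y < f a := hsub (mem_filter.2 ⟨ha, hab⟩)
      exact lt_irrefl _ (mem_filter.1 this).2
  constructor
  · intro h
    by_contra hle
    push Not at hle
    have := mono q x hle
    zify at this; linarith
  · intro h
    exact_mod_cast strict x q hx h

/-- The rank has the order of `f` on `R`: equality part. -/
theorem rank_eq_iff (R : Finset (EuclideanSpace ℝ (Fin 3))) (f : EuclideanSpace ℝ (Fin 3) → ℝ)
    (x q : EuclideanSpace ℝ (Fin 3)) (hx : x ∈ R) (hq : q ∈ R) :
    ((R.filter fun y => f y < f x).card : ℤ) = ((R.filter fun y => f y < f q).card : ℤ) ↔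
      f x = f q := by
  constructor
  · intro h
    rcases lt_trichotomy (f x) (f q) with hlt | heq | hgt
    · have := (rank_lt_iff R f x q hx).2 hlt; linarith
    · exact heq
    · have := (rank_lt_iff R f q x hq).2 hgt; linarith
  · intro h
    simp only [h]

/-! ### The reduction -/

/-- **Only the off-registry balls need a certificate.**  `X ⊇ P` a finite unit packing around
the `ν`-slab sample `P` (`R > 0`, `ρ > 0`), `O ⊆ X \ P` a set of film balls whose complement in
the film consists of sites of `Λ₀`, `E` any set, and `Ψ` an integer potential satisfying (T2) at
every `q ∈ O \ E` for the ENLARGED plug `X \ O`.  Then some integer potential satisfies (T2) relative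
to `P` at every film ball off `E`. -/
theorem exists_potential_of_offRegistry (ν : EuclideanSpace ℝ (Fin 3)) (hν : ‖ν‖ = 1) (R ρ : ℝ)
    (hR : 0 < R) (hρ : 0 < ρ) (X P O E : Finset (EuclideanSpace ℝ (Fin 3))) (hPX : P ⊆ X)
    (hP : ∀ p, p ∈ P ↔ (p ∈ fccStacking 1 (Real.sqrt (2 / 3)) ∧ -(2 * R) ≤ ⟪p, ν⟫_ℝ ∧
      ⟪p, ν⟫_ℝ ≤ -R ∧ ‖p‖ ^ 2 - ⟪p, ν⟫_ℝ ^ 2 ≤ ρ ^ 2))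
    (hO : O ⊆ X \ P) (hreg : ∀ x ∈ (X \ P) \ O, x ∈ fccStacking 1 (Real.sqrt (2 / 3)))
    (Ψ : EuclideanSpace ℝ (Fin 3) → ℤ)
    (hΨ : ∀ q ∈ O \ E,
      (((X \ (X \ O)).filter fun x => dist q x = 1 ∧ Ψ x < Ψ q).card : ℤ)
          + (((X \ O).filter fun p => dist q p = 1).card : ℤ)
        ≤ (12 - ((X.filter fun x => dist q x = 1).card : ℤ))
          + (((X \ (X \ O)).filter fun x => dist q x = 1 ∧ Ψ q < Ψ x).card : ℤ)) :
    ∃ Φ : EuclideanSpace ℝ (Fin 3) → ℤ, ∀ q ∈ (X \ P) \ E,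
      (((X \ P).filter fun x => dist q x = 1 ∧ Φ x < Φ q).card : ℤ)
          + ((P.filter fun p => dist q p = 1).card : ℤ)
        ≤ (12 - ((X.filter fun x => dist q x = 1).card : ℤ))
          + (((X \ P).filter fun x => dist q x = 1 ∧ Φ q < Φ x).card : ℤ) := by
  classical
  set Rg := (X \ P) \ O with hRg
  have hOX : O ⊆ X := hO.trans sdiff_subset
  have hXO : X \ (X \ O) = O := Finset.sdiff_sdiff_eq_self hOX
  -- the gauge and its rank on the registry film
  set f : EuclideanSpace ℝ (Fin 3) → ℝ := fun y =>
    max (ρ ^ 2 * (2 * ⟪y, ν⟫_ℝ + 3 * R) ^ 2) (R ^ 2 * (‖y‖ ^ 2 - ⟪y, ν⟫_ℝ ^ 2)) with hf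
  set rk : EuclideanSpace ℝ (Fin 3) → ℤ := fun x => ((Rg.filter fun y => f y < f x).card : ℤ) with hrk
  have hrk_le : ∀ x, rk x ≤ Rg.card := fun x => by
    simp only [hrk]; exact_mod_cast card_le_card (filter_subset _ _)
  have hrk_nn : ∀ x, 0 ≤ rk x := fun x => by simp only [hrk]; positivity
  -- lift `Ψ` above every rank
  set M : ℤ := (Rg.card : ℤ) + 1 + ∑ y ∈ O, |Ψ y| with hM
  have hMbig : ∀ x, ∀ y ∈ O, rk x < Ψ y + M := by
    intro x y hy
    have h1 : -|Ψ y| ≤ Ψ y := neg_abs_le _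
    have h2 : |Ψ y| ≤ ∑ y ∈ O, |Ψ y| := single_le_sum (fun z _ => abs_nonneg (Ψ z)) hy
    have := hrk_le x
    linarith
  let Φ : EuclideanSpace ℝ (Fin 3) → ℤ := fun y => if y ∈ O then Ψ y + M else rk y
  have hΦO : ∀ y ∈ O, Φ y = Ψ y + M := fun y hy => by simp [Φ, hy]
  have hΦR : ∀ y, y ∉ O → Φ y = rk y := fun y hy => by simp [Φ, hy]
  refine ⟨Φ, fun q hq => ?_⟩
  rw [mem_sdiff] at hq
  obtain ⟨hqXP, hqE⟩ := hq
  by_cases hqO : q ∈ O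
  · -- an off-registry ball: the hypothesis, re-counted
    have h := hΨ q (mem_sdiff.2 ⟨hqO, hqE⟩)
    rw [noGainPotential_iff X (X \ O) sdiff_subset Ψ q, hXO] at h
    rw [noGainPotential_iff X P hPX Φ q]
    have hq' : Φ q = Ψ q + M := hΦO q hqO
    -- below: `O`-below plus all registry partners
    have hb : ((X \ P).filter fun x => dist q x = 1 ∧ Φ x < Φ q).card =
        (O.filter fun x => dist q x = 1 ∧ Ψ x < Ψ q).card + (Rg.filter fun x => dist q x = 1).card := by
      rw [← card_union_of_disjoint]
      · congr 1
        ext x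
        simp only [mem_union, mem_filter, hRg, mem_sdiff]
        constructor
        · rintro ⟨hx, hd, hlt⟩
          by_cases hxO : x ∈ O
          · left; refine ⟨hxO, hd, ?_⟩; rw [hΦO x hxO, hq'] at hlt; linarith
          · right; exact ⟨⟨hx, hxO⟩, hd⟩
        · rintro (⟨hxO, hd, hlt⟩ | ⟨⟨hx, hxO⟩, hd⟩)
          · refine ⟨mem_sdiff.1 (hO hxO), hd, ?_⟩; rw [hΦO x hxO, hq']; linarith
          · refine ⟨hx, hd, ?_⟩; rw [hΦR x hxO, hq']; exact hMbig x q hqO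
      · exact disjoint_left.2 fun x h1 h2 => by
          rw [mem_filter] at h1 h2; exact (mem_sdiff.1 h2.1).2 h1.1
    -- level: only `O`-level
    have hl : ((X \ P).filter fun x => dist q x = 1 ∧ Φ x = Φ q) =
        (O.filter fun x => dist q x = 1 ∧ Ψ x = Ψ q) := by
      ext x
      simp only [mem_filter]
      constructor
      · rintro ⟨hx, hd, he⟩
        by_cases hxO : x ∈ O
        · refine ⟨hxO, hd, ?_⟩; rw [hΦO x hxO, hq'] at he; linarith
        · exfalso; rw [hΦR x hxO, hq'] at he; exact absurd he (hMbig x q hqO).ne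
      · rintro ⟨hxO, hd, he⟩
        refine ⟨hO hxO, hd, ?_⟩; rw [hΦO x hxO, hq', he]
    -- plug: `P`-partners plus registry partners
    have hc : ((X \ O).filter fun p => dist q p = 1).card =
        (P.filter fun p => dist q p = 1).card + (Rg.filter fun x => dist q x = 1).card := by
      rw [← card_union_of_disjoint]
      · congr 1
        ext x
        simp only [mem_union, mem_filter, hRg, mem_sdiff]
        constructor
        · rintro ⟨⟨hx, hxO⟩, hd⟩
          by_cases hxP : x ∈ P
          · exact Or.inl ⟨hxP, hd⟩
          · exact Or.inr ⟨⟨⟨hx, hxP⟩, hxO⟩, hd⟩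
        · rintro (⟨hxP, hd⟩ | ⟨⟨⟨hx, hxP⟩, hxO⟩, hd⟩)
          · exact ⟨⟨hPX hxP, fun hxO => (mem_sdiff.1 (hO hxO)).2 hxP⟩, hd⟩
          · exact ⟨⟨hx, hxO⟩, hd⟩
      · exact disjoint_left.2 fun x h1 h2 => by
          rw [mem_filter] at h1 h2; exact (mem_sdiff.1 (mem_sdiff.1 h2.1).1).2 h1.1
    rw [hb, hl]; rw [hc] at h
    push_cast at h ⊢
    linarith
  · -- a registry ball: the antipodal-pair argument with the gauge order
    have hqR : q ∈ Rg := by rw [hRg]; exact mem_sdiff.2 ⟨hqXP, hqO⟩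
    have hqΛ := hreg q hqR
    have hq' : Φ q = rk q := hΦR q hqO
    refine registry_noGainPotential X P Rg hPX sdiff_subset (fun p hp => ((hP p).1 hp).1) hreg q hqR
      Φ f ?_ ?_ ?_ ?_ ?_
    · intro x hx _
      have hxO : x ∈ O := by
        rw [hRg, Finset.sdiff_sdiff_eq_self hO] at hx; exact hx
      rw [hq', hΦO x hxO]; exact hMbig q x hxO
    · intro x hx _
      have hxO : x ∉ O := (mem_sdiff.1 hx).2
      rw [hq', hΦR x hxO]; exact rank_lt_iff Rg f x q hx
    · intro x hx _
      have hxO : x ∉ O := (mem_sdiff.1 hx).2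
      rw [hq', hΦR x hxO]; exact rank_eq_iff Rg f x q hx hqR
    · intro p hp _
      obtain ⟨-, h1, h2, h3⟩ := (hP p).1 hp
      have hqP : q ∉ P := (mem_sdiff.1 hqXP).2
      have hnot : ¬(-(2 * R) ≤ ⟪q, ν⟫_ℝ ∧ ⟪q, ν⟫_ℝ ≤ -R ∧ ‖q‖ ^ 2 - ⟪q, ν⟫_ℝ ^ 2 ≤ ρ ^ 2) :=
        fun h => hqP ((hP q).2 ⟨hqΛ, h⟩)
      exact lt_of_le_of_lt (slabGauge_le ν R ρ p h1 h2 h3) (lt_slabGauge ν R ρ hR hρ q hnot)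
    · intro w
      exact slabGauge_midpoint ν hν R ρ q w

/-- **`PotentialCertificateExists` from off-registry certificates** (R26 reduction L5, kernel
form; both statements unfolded, cf-p2's shapes).  If for some `R ≥ 1`, `C`, around every `ν`-slab
sample the OFF-REGISTRY film balls `O` (those not on sites of `Λ₀`) admit an integer potential
satisfying (T2) for the enlarged plug `X \ O` off a rim set of `≤ C ρ` of them, then
`PotentialCertificateExists` holds with the same constants (hence the atom, by
`adhesion_of_certificate`).  Each ball of `O` has at most three partners in the enlarged plug
(`fcc_offLattice_unitContacts_le_three`). -/
theorem potentialCertificateExists_of_offRegistry :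
    (∃ R C : ℝ, 1 ≤ R ∧ ∀ ν : EuclideanSpace ℝ (Fin 3), ‖ν‖ = 1 → ∀ ρ : ℝ, R ≤ ρ →
      ∀ X P : Finset (EuclideanSpace ℝ (Fin 3)),
      (∀ p ∈ X, ∀ q ∈ X, p ≠ q → 1 ≤ dist p q) → P ⊆ X →
      (∀ p, p ∈ P ↔ (p ∈ fccStacking 1 (Real.sqrt (2 / 3)) ∧ -(2 * R) ≤ ⟪p, ν⟫_ℝ ∧
        ⟪p, ν⟫_ℝ ≤ -R ∧ ‖p‖ ^ 2 - ⟪p, ν⟫_ℝ ^ 2 ≤ ρ ^ 2)) →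
      ∀ O : Finset (EuclideanSpace ℝ (Fin 3)), O ⊆ X \ P →
      (∀ x ∈ (X \ P) \ O, x ∈ fccStacking 1 (Real.sqrt (2 / 3))) →
      (∀ x ∈ O, x ∉ fccStacking 1 (Real.sqrt (2 / 3))) →
      ∃ (Ψ : EuclideanSpace ℝ (Fin 3) → ℤ) (E : Finset (EuclideanSpace ℝ (Fin 3))),
        E ⊆ O ∧ (E.card : ℝ) ≤ C * ρ ∧
        ∀ q ∈ O \ E,
          (((X \ (X \ O)).filter fun x => dist q x = 1 ∧ Ψ x < Ψ q).card : ℤ)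
              + (((X \ O).filter fun p => dist q p = 1).card : ℤ)
            ≤ (12 - ((X.filter fun x => dist q x = 1).card : ℤ))
              + (((X \ (X \ O)).filter fun x => dist q x = 1 ∧ Ψ q < Ψ x).card : ℤ)) →
    (∃ R C : ℝ, 1 ≤ R ∧ ∀ ν : EuclideanSpace ℝ (Fin 3), ‖ν‖ = 1 → ∀ ρ : ℝ, R ≤ ρ →
      ∀ X P : Finset (EuclideanSpace ℝ (Fin 3)),
      (∀ p ∈ X, ∀ q ∈ X, p ≠ q → 1 ≤ dist p q) → P ⊆ X →
      (∀ p, p ∈ P ↔ (p ∈ fccStacking 1 (Real.sqrt (2 / 3)) ∧ -(2 * R) ≤ ⟪p, ν⟫_ℝ ∧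
        ⟪p, ν⟫_ℝ ≤ -R ∧ ‖p‖ ^ 2 - ⟪p, ν⟫_ℝ ^ 2 ≤ ρ ^ 2)) →
      ∃ (Φ : EuclideanSpace ℝ (Fin 3) → ℤ) (E : Finset (EuclideanSpace ℝ (Fin 3))),
        E ⊆ X \ P ∧ (E.card : ℝ) ≤ C * ρ ∧
        ∀ q ∈ (X \ P) \ E,
          (((X \ P).filter fun x => dist q x = 1 ∧ Φ x < Φ q).card : ℤ)
              + ((P.filter fun p => dist q p = 1).card : ℤ)
            ≤ (12 - ((X.filter fun x => dist q x = 1).card : ℤ))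
              + (((X \ P).filter fun x => dist q x = 1 ∧ Φ q < Φ x).card : ℤ)) := by
  classical
  rintro ⟨R, C, hR, h⟩
  refine ⟨R, C, hR, fun ν hν ρ hρ X P hX hPX hP => ?_⟩
  set O := (X \ P).filter fun x => x ∉ fccStacking 1 (Real.sqrt (2 / 3)) with hOdef
  have hO : O ⊆ X \ P := filter_subset _ _
  have hreg : ∀ x ∈ (X \ P) \ O, x ∈ fccStacking 1 (Real.sqrt (2 / 3)) := by
    intro x hx
    rw [mem_sdiff, hOdef, mem_filter] at hx
    by_contra hxΛ
    exact hx.2 ⟨hx.1, hxΛ⟩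
  have hoff : ∀ x ∈ O, x ∉ fccStacking 1 (Real.sqrt (2 / 3)) := fun x hx => (mem_filter.1 hx).2
  obtain ⟨Ψ, E, hE, hEcard, hΨ⟩ := h ν hν ρ hρ X P hX hPX hP O hO hreg hoff
  obtain ⟨Φ, hΦ⟩ := exists_potential_of_offRegistry ν hν R ρ (by linarith) (by linarith) X P O E hPX
    hP hO hreg Ψ hΨ
  exact ⟨Φ, E, hE.trans hO, hEcard, hΦ⟩

end Summit.Ventures.Crystal3D.Theorems
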